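import Summits.HodgeConjecture.HodgeConjecture.Theorems.F0P3cStCharTSWeylHypFibre        -- ★ p849559 (A0)(A0′)(A1)(A3) (this seat)
import Summits.HodgeConjecture.HodgeConjecture.Theorems.F0P3cStCharTSWeylHypNormaliser   -- ★ p849560 (A2) `mem_normalizer_torusU_antidiag_three_iff` (this seat)
import Summits.HodgeConjecture.HodgeConjecture.Theorems.F0P3cStCharTSTorusRay           -- ★ p849400 `exists_uniformizer_units`, `coe_apply_ne_zero` (LH6-p05)
import Literature.NumberTheory.Automorphic.CMPrincipalSeriesSpherical                   -- ★ `v_conjLocal_apply`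
import Literature.NumberTheory.Automorphic.UnitaryGroupNonsplitPlace                    -- ★ `PlacesOver.subsingleton_of_smul_eq`, `LocalRing.eq_iff_apply_eq`
import HarnessLib

/-!
# F0 · P3c · line LH6 «StCharTS» — «WEYL-HYP★» (B0): THE CM CARRIER — a REGULAR element of the split torus, `E_v` FIELD-LIKE at a non-split place, and
# `N(M) = M ⊔ w·M` UNCONDITIONALLY on `U(Φ₃)(L⁺_v)` [Rogawski1990 §12.2 p. 173, §12.5 p. 182]

Cell `pub/hodgecm-mathlib`, crux H413 = `stmt-HodgeConjecture-24833` (`--supports` lane, helper), route HCCMUnconditional; seat LH2-p01 (g3), deal «(B0)» of F0P3b-plan (g23)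
2026-09-02T05:37:41Z (after ★ p849559 ∕ p849560 «WEYL-HYP★ stage (A)»).  THEOREMS ONLY, sorry-free, no definition ∕ instance ∕ notation ∕ named fact.
THE CARRIER: `G = U(Φ₃)(L⁺_v) = ↥(unitaryGroupOfForm (conjLocal L c v) (cmLocalForm L 3 v))` (`= (cmDatum L 3 Φ₃).Local v = Gqs L v`, ★ `cmDatum_Local_eq`), the split torus
`M = (cmBorelTriple L 3 v).M = torusU …` (★ `borelTriple_M`), `E_v = LocalRing L v = Π_{w∣v} L_w`, `σ = c ⊗ 1 = conjLocal L c v`.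
* §1 `isUnit_of_forall_apply_ne_zero`, `nontrivial_localRing`, **`isUnit_of_ne_zero_of_nonsplit`** — at a NON-SPLIT `v` (`∀ w ∣ v, c•w = w`: ONE place above `v`, ★
  `PlacesOver.subsingleton_of_smul_eq`) every non-zero element of `E_v` is a unit (= the hypothesis `hR` of ★ (A2); cf. ★ `LocalRing.isField_of_smul_eq`).
* §2 **`exists_mem_torusU_isRegularElt`** — at EVERY finite `v`, the split torus has a REGULAR element: `m = d(ϖ, 1, σ(ϖ)⁻¹)` for a uniformiser unit `ϖ ∈ E_vˣ` (★
  `exists_uniformizer_units`): it is `Φ₃`-unitary (`σ(d_i) d_{2−i} = 1`, ★ `conjLocal_conjLocal_cm`) and its three eigenvalues have pairwise UNIT differences (valuations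
  `exp(−1), 1, exp(+1)` at every `w ∣ v`, ★ `v_conjLocal_apply`), hence `IsRegularElt` (separable `∏ (X − dᵢ)`: Mathlib `separable_prod` + `isCoprime_X_sub_C_of_isUnit_sub`)
  (= the hypothesis `hex` of ★ (A2)).
* §3 **`mem_normalizer_cmTorus_iff_of_nonsplit`** — (A2) UNCONDITIONAL on the CM carrier at a non-split `v`: `g ∈ N(M) ↔` the matrix of `g` is diagonal or anti-diagonal
  (`N(M) = M ⊔ w·M`, `|W| = 2`); and `centralizer_eq_cmTorus_of_isRegularElt` — (A1) read on `(cmBorelTriple L 3 v).M`.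
HONEST LABEL: HC_CM is proved only modulo the 7 printed citations (2 remaining: hLiu418 = `stmt-HodgeConjecture-24832`, h413 = `stmt-HodgeConjecture-24833`) until rung 0
closes; count-neutral (TOR)-road brick of the Weyl integration formula on the hyperbolic set; closes no organ.

## References
* [Rogawski1990] J. D. Rogawski, *Automorphic Representations of Unitary Groups in Three Variables*, Ann. of Math. Stud. 123 (1990), §12.2 p. 173 (`M ≅ E* × E¹`, `W = {1, w}`),
  §12.5 p. 182 (Weyl integration on the split torus), §1.10 p. 9.
* [vanDijk1972] G. van Dijk, *Computation of certain induced characters of `p`-adic groups*, Math. Ann. 199 (1972), §2.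
* [CasselsFrohlichANT1967] J. W. S. Cassels, A. Fröhlich (eds.), *Algebraic Number Theory* (1967), Ch. II §10 (`L ⊗_K K_v = ∏ L_w`; one factor at a non-split place).
-/

set_option autoImplicit false
-- the mandated namespace has the single-problem summit's repeated segment (`HodgeConjecture.HodgeConjecture`)
set_option linter.dupNamespace false

noncomputable section

open NumberField IsDedekindDomain Matrix Polynomial
open Literature.NumberTheory.Automorphic Literature.NumberTheory.Automorphic.UnitaryGroup Literature.NumberTheory.Rogawski1990
open Summit.HodgeConjecture.HodgeConjecture.Cruxes.H413.F0P3cStCharTSWeylHypFibre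
open Summit.HodgeConjecture.HodgeConjecture.Cruxes.H413.F0P3cStCharTSWeylHypNormaliser
open Summit.HodgeConjecture.HodgeConjecture.Cruxes.H413.F0P3cStCharTSTorusRay
open scoped MatrixGroups

namespace Summit.HodgeConjecture.HodgeConjecture.Cruxes.H413.F0P3cStCharTSWeylHypCM

variable (L : Type) [Field L] [NumberField L] [IsCMField L] (v : HeightOneSpectrum (𝓞 ↥(maximalRealSubfield L)))

/-! ## §1 `E_v = Π_{w∣v} L_w`: units, non-triviality, and the field-like property at a non-split place -/

omit [IsCMField L] in
/-- An element of `E_v = Π_{w∣v} L_w` with all components non-zero is a unit. [cite: CasselsFrohlichANT1967, Ch. II §10] -/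
theorem isUnit_of_forall_apply_ne_zero (x : LocalRing L v) (h : ∀ w : PlacesOver L v, x w ≠ 0) : IsUnit x :=
  ⟨⟨x, fun w => (x w)⁻¹, funext fun w => mul_inv_cancel₀ (h w), funext fun w => inv_mul_cancel₀ (h w)⟩, rfl⟩

omit [IsCMField L] in
/-- `E_v` is a non-trivial ring (there is a place above `v`). [cite: CasselsFrohlichANT1967, Ch. II §10] -/
theorem nontrivial_localRing : Nontrivial (LocalRing L v) := by
  obtain ⟨w⟩ := (inferInstance : Nonempty (PlacesOver L v))
  exact ⟨⟨0, 1, fun h => zero_ne_one (congrFun h w)⟩⟩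

/-- **`E_v` is FIELD-LIKE at a non-split place**: if `c • w = w` for every `w ∣ v` (equivalently: one place above `v`), every non-zero `x ∈ E_v` is a unit — the hypothesis
`hR` of ★ `mem_normalizer_torusU_antidiag_three_iff`. [cite: CasselsFrohlichANT1967, Ch. II §10] [cite: Rogawski1990, §12.2 p. 173] -/
theorem isUnit_of_ne_zero_of_nonsplit (hns : ∀ w : PlacesOver L v, IsCMField.complexConj L • w.1 = w.1) (x : LocalRing L v) (hx : x ≠ 0) : IsUnit x := by
  haveI : Algebra.IsQuadraticExtension ↥(maximalRealSubfield L) L := IsCMField.isQuadraticExtension L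
  obtain ⟨w⟩ := (inferInstance : Nonempty (PlacesOver L v))
  haveI := PlacesOver.subsingleton_of_smul_eq (IsCMField.complexConj L) (IsCMField.complexConj_ne_one L) w (hns w)
  have hxw : x w ≠ 0 := fun h0 =>
    hx ((LocalRing.eq_iff_apply_eq (IsCMField.complexConj L) (IsCMField.complexConj_ne_one L) w (hns w) x 0).2 h0)
  refine isUnit_of_forall_apply_ne_zero L v x fun w' => ?_
  rw [Subsingleton.elim w' w]
  exact hxw

/-! ## §2 A regular element of the split torus: `d(ϖ, 1, σ(ϖ)⁻¹)` -/

omit [IsCMField L] in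
/-- Elements of `L_w` with different valuations are different: `|a| ≠ |b| → a − b ≠ 0`. [folklore] -/
theorem sub_ne_zero_of_valued_ne {w : PlacesOver L v} {a b : w.1.adicCompletion L} (h : Valued.v a ≠ Valued.v b) : a - b ≠ 0 :=
  fun h0 => h (by rw [sub_eq_zero.1 h0])

/-- **THE SPLIT TORUS OF `U(Φ₃)(L⁺_v)` HAS A REGULAR ELEMENT** (every finite `v`): `m = d(ϖ, 1, σ(ϖ)⁻¹) ∈ M` with `ϖ ∈ E_vˣ` a uniformiser at every `w ∣ v` is `Φ₃`-unitary and
`IsRegularElt` — its eigenvalues have valuations `exp(−1), 1, exp(1)` at each `w`, so their pairwise differences are units and `∏ (X − dᵢ)` is separable.  This is the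
hypothesis `hex` of ★ `mem_normalizer_torusU_antidiag_three_iff`. [cite: Rogawski1990, §12.2 p. 173; §12.5 p. 182] -/
theorem exists_mem_torusU_isRegularElt :
    ∃ m : ↥(unitaryGroupOfForm (conjLocal L (IsCMField.complexConj L) v) (cmLocalForm L 3 v)),
      m ∈ torusU (conjLocal L (IsCMField.complexConj L) v) (cmLocalForm L 3 v) ∧
        IsRegularElt (m : GL (Fin 3) (LocalRing L v)) := by
  obtain ⟨ϖ, hϖ⟩ := exists_uniformizer_units L v
  set σ : LocalRing L v →+* LocalRing L v := conjLocal L (IsCMField.complexConj L) v with hσ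
  -- `σ(ϖ)` as a unit and the three eigenvalues
  set ϖσ : (LocalRing L v)ˣ := Units.map (σ : LocalRing L v →* LocalRing L v) ϖ with hϖσ
  have hϖσval : ∀ w : PlacesOver L v, Valued.v ((ϖσ : LocalRing L v) w) = WithZero.exp (-1 : ℤ) := fun w => by
    show Valued.v (conjLocal L (IsCMField.complexConj L) v (ϖ : LocalRing L v) w) = _
    rw [v_conjLocal_apply]
    exact hϖ _
  set d : Fin 3 → (LocalRing L v)ˣ := ![ϖ, 1, ϖσ⁻¹] with hd
  -- valuations of the components: `exp(−1), 1, exp(1)`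
  have hval0 : ∀ w : PlacesOver L v, Valued.v (((d 0 : (LocalRing L v)ˣ) : LocalRing L v) w) = WithZero.exp (-1 : ℤ) := fun w => hϖ w
  have hval1 : ∀ w : PlacesOver L v, Valued.v (((d 1 : (LocalRing L v)ˣ) : LocalRing L v) w) = 1 := fun w => by
    show Valued.v ((1 : LocalRing L v) w) = 1
    rw [Pi.one_apply, map_one]
  have hval2 : ∀ w : PlacesOver L v, Valued.v (((d 2 : (LocalRing L v)ˣ) : LocalRing L v) w) = WithZero.exp (1 : ℤ) := fun w => by
    show Valued.v (((ϖσ⁻¹ : (LocalRing L v)ˣ) : LocalRing L v) w) = _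
    have h1 : ((ϖσ⁻¹ : (LocalRing L v)ˣ) : LocalRing L v) w = (((ϖσ : (LocalRing L v)ˣ) : LocalRing L v) w)⁻¹ := by
      have e : ((ϖσ⁻¹ : (LocalRing L v)ˣ) : LocalRing L v) w * ((ϖσ : (LocalRing L v)ˣ) : LocalRing L v) w = 1 := by
        rw [← Pi.mul_apply, Units.inv_mul, Pi.one_apply]
      exact eq_inv_of_mul_eq_one_left e
    rw [h1, map_inv₀, hϖσval, ← WithZero.exp_neg, neg_neg]
  -- pairwise unit differences
  have hm1 : WithZero.exp (-1 : ℤ) ≠ (1 : WithZero (Multiplicative ℤ)) := by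
    rw [← WithZero.exp_zero]; exact fun h => by have := WithZero.exp_injective h; omega
  have hp1 : WithZero.exp (1 : ℤ) ≠ (1 : WithZero (Multiplicative ℤ)) := by
    rw [← WithZero.exp_zero]; exact fun h => by have := WithZero.exp_injective h; omega
  have hmp : WithZero.exp (-1 : ℤ) ≠ WithZero.exp (1 : ℤ) := fun h => by have := WithZero.exp_injective h; omega
  have hreg : ∀ i j : Fin 3, i ≠ j → IsUnit (((d i : (LocalRing L v)ˣ) : LocalRing L v) - d j) := by
    intro i j hij
    refine isUnit_of_forall_apply_ne_zero L v _ fun w => ?_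
    rw [Pi.sub_apply]
    refine sub_ne_zero_of_valued_ne L v ?_
    have h01 : Valued.v (((d 0 : (LocalRing L v)ˣ) : LocalRing L v) w) ≠ Valued.v (((d 1 : (LocalRing L v)ˣ) : LocalRing L v) w) := by
      rw [hval0, hval1]; exact hm1
    have h02 : Valued.v (((d 0 : (LocalRing L v)ˣ) : LocalRing L v) w) ≠ Valued.v (((d 2 : (LocalRing L v)ˣ) : LocalRing L v) w) := by
      rw [hval0, hval2]; exact hmp
    have h12 : Valued.v (((d 1 : (LocalRing L v)ˣ) : LocalRing L v) w) ≠ Valued.v (((d 2 : (LocalRing L v)ˣ) : LocalRing L v) w) := by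
      rw [hval1, hval2]; exact hp1.symm
    fin_cases i <;> fin_cases j
    · exact absurd rfl hij
    · exact h01
    · exact h02
    · exact h01.symm
    · exact absurd rfl hij
    · exact h12
    · exact h02.symm
    · exact h12.symm
    · exact absurd rfl hij
  -- `Φ₃`-unitarity of `diag(d)`: `σ(d_i) d_{2−i} = 1`
  have hσσ : ∀ x : LocalRing L v, σ (σ x) = x := conjLocal_conjLocal_cm L v
  have e0 : σ (ϖ : LocalRing L v) * ((ϖσ⁻¹ : (LocalRing L v)ˣ) : LocalRing L v) = 1 := by
    show ((ϖσ : (LocalRing L v)ˣ) : LocalRing L v) * ((ϖσ⁻¹ : (LocalRing L v)ˣ) : LocalRing L v) = 1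
    rw [Units.mul_inv]
  have e2 : σ ((ϖσ⁻¹ : (LocalRing L v)ˣ) : LocalRing L v) * (ϖ : LocalRing L v) = 1 := by
    have h1 : σ ((ϖσ⁻¹ : (LocalRing L v)ˣ) : LocalRing L v) = ((ϖ⁻¹ : (LocalRing L v)ˣ) : LocalRing L v) := by
      have hinv : ((ϖσ⁻¹ : (LocalRing L v)ˣ) : LocalRing L v) = σ ((ϖ⁻¹ : (LocalRing L v)ˣ) : LocalRing L v) := by
        rw [hϖσ, ← map_inv, Units.coe_map]; rfl
      rw [hinv, hσσ]
    rw [h1, Units.inv_mul]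
  have hmem : glDiagonal 3 (LocalRing L v) d ∈ unitaryGroupOfForm σ (cmLocalForm L 3 v) := by
    rw [mem_unitaryGroupOfForm_iff, coe_glDiagonal, cmLocalForm_eq_over]
    have ht : ((diagonal fun k : Fin 3 => ((d k : (LocalRing L v)ˣ) : LocalRing L v)).map σ)ᵀ = diagonal fun k => σ ((d k : (LocalRing L v)ˣ) : LocalRing L v) := by
      rw [diagonal_map (map_zero σ), diagonal_transpose]
    rw [ht]
    refine Matrix.ext fun i j => ?_
    rw [mul_diagonal, diagonal_mul, antidiagonal_over_apply]
    have hd0 : d 0 = ϖ := rfl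
    have hd1 : d 1 = 1 := rfl
    have hd2 : d 2 = ϖσ⁻¹ := rfl
    split_ifs with h
    · subst h
      fin_cases i
      · show σ ((d 0 : (LocalRing L v)ˣ) : LocalRing L v) * 1 * ((d 2 : (LocalRing L v)ˣ) : LocalRing L v) = 1
        rw [hd0, hd2, mul_one]; exact e0
      · show σ ((d 1 : (LocalRing L v)ˣ) : LocalRing L v) * 1 * ((d 1 : (LocalRing L v)ˣ) : LocalRing L v) = 1
        rw [hd1, Units.val_one, map_one, mul_one, mul_one]
      · show σ ((d 2 : (LocalRing L v)ˣ) : LocalRing L v) * 1 * ((d 0 : (LocalRing L v)ˣ) : LocalRing L v) = 1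
        rw [hd0, hd2, mul_one]; exact e2
    · rw [mul_zero, zero_mul]
  refine ⟨⟨glDiagonal 3 (LocalRing L v) d, hmem⟩, ⟨d, rfl⟩, ?_⟩
  show IsRegularElt (glDiagonal 3 (LocalRing L v) d)
  rw [IsRegularElt, coe_glDiagonal, Matrix.charpoly_diagonal]
  exact separable_prod (fun i j hij => isCoprime_X_sub_C_of_isUnit_sub (hreg i j hij)) fun _ => separable_X_sub_C

/-! ## §3 (A1) and (A2) on the CM carrier `U(Φ₃)(L⁺_v)`, unconditionally at a non-split place -/

/-- **(A1) on `M = (cmBorelTriple L 3 v).M`**: a regular element of the split torus of `U(Φ₃)(L⁺_v)` has centraliser `M` (every finite `v`).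
[cite: Rogawski1990, §12.5 p. 182] -/
theorem centralizer_eq_cmTorus_of_isRegularElt {m : ↥(unitaryGroupOfForm (conjLocal L (IsCMField.complexConj L) v) (cmLocalForm L 3 v))}
    (hm : m ∈ (cmBorelTriple L 3 v).M) (hreg : IsRegularElt (m : GL (Fin 3) (LocalRing L v))) :
    Subgroup.centralizer ({m} : Set ↥(unitaryGroupOfForm (conjLocal L (IsCMField.complexConj L) v) (cmLocalForm L 3 v))) = (cmBorelTriple L 3 v).M := by
  rw [borelTriple_M] at hm ⊢
  exact centralizer_eq_torusU_of_isRegularElt _ _ hm hreg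

/-- **(A2) UNCONDITIONAL on `U(Φ₃)(L⁺_v)` at a NON-SPLIT place: `N(M) = M ⊔ w·M`** — `g` normalises the split torus `M = (cmBorelTriple L 3 v).M` iff the matrix of `g` is
DIAGONAL or ANTI-DIAGONAL (★ (A2) with `hR` = §1 and `hex` = §2 discharged).  The Weyl group of `M` in `G` has order `2`. [cite: Rogawski1990, §12.2 p. 173; §12.5 p. 182] [cite: vanDijk1972, §2] -/
theorem mem_normalizer_cmTorus_iff_of_nonsplit (hns : ∀ w : PlacesOver L v, IsCMField.complexConj L • w.1 = w.1)
    (g : ↥(unitaryGroupOfForm (conjLocal L (IsCMField.complexConj L) v) (cmLocalForm L 3 v))) :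
    g ∈ Subgroup.normalizer ((cmBorelTriple L 3 v).M : Set ↥(unitaryGroupOfForm (conjLocal L (IsCMField.complexConj L) v) (cmLocalForm L 3 v))) ↔
      (∀ i j : Fin 3, i ≠ j → ((g : GL (Fin 3) (LocalRing L v)) : Matrix (Fin 3) (Fin 3) (LocalRing L v)) i j = 0) ∨
        (∀ i j : Fin 3, j ≠ i.rev → ((g : GL (Fin 3) (LocalRing L v)) : Matrix (Fin 3) (Fin 3) (LocalRing L v)) i j = 0) := by
  haveI := nontrivial_localRing L v
  rw [borelTriple_M]
  exact mem_normalizer_torusU_antidiag_three_iff _ (isUnit_of_ne_zero_of_nonsplit L v hns) (cmLocalForm_eq_over L 3 v)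
    (exists_mem_torusU_isRegularElt L v) g

end Summit.HodgeConjecture.HodgeConjecture.Cruxes.H413.F0P3cStCharTSWeylHypCM
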